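import Summits.CriticalPhenomena.Ising3DConformalLimit.Theorems.IsingEuclidUpgradeR2RotInvPowerLaw.Negative.LaplaceGauge
import HarnessLib

/-!
# Crux `IsingEuclidUpgradeR2RotInvPowerLaw` (stmt-CriticalPhenomena-0634) — negative-side support, V: the axis toolkit does not see S2 (W4)

Standing crux disprover (cdisprove cycle 1, 2026-08-17), THEOREM-ONLY file; finding F2′ of
`Cruxes/IsingEuclidUpgradeR2RotInvPowerLaw/Disproof.lean`.

The stubs T1 (`stub_dyadicTowerLaw`) and S2 (`stub_integerDilationLaw`) of line `tower_profile_rigidity` are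
statements about the AXIS sequence `g(n) = ⟨σ₀σ_{n e₀}⟩_{β_c}` alone. Everything the tree knows about that sequence
is: positivity, `g(n+1) ≤ g(n)` (Messager–Miracle-Solé / `criticalTwoPoint_axis_succ_le`), log-convexity
`g(n)² ≤ g(n-1)g(n+1)` (`criticalTwoPoint_axis_sq_le`), the envelope `c/n² ≤ g ≤ C/n`
(`criticalTwoPoint_bounds_holds`), and — from reflection positivity in the mirror `x₀ = 0` — that `g` is
positive definite on the half-line semigroup, `Σ c_a c_b g(p_a + p_b) ≥ 0` (`CriticalCorrNineMirrorRP_holds`).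

**Witness W4** = the sequence `g n = h (max n ½)` of the reflection-positive log₂-periodic Laplace gauge of
`Negative/LaplaceGauge.lean`. It has ALL of the above and satisfies T1 EXACTLY (`g(2^j)·2^j = h 1`), yet violates
S2 for every exponent (`k = 2` forces `2Δ = 1`, and the `k = 3` ratio along the dyadic tower is the constant
`3h(3)/h(1) ≠ 1`).

* `lap_integerDilationLaw_not_of_axisToolkit` — {positivity, antitone, log-convex, half-line RP, envelope, T1} ⊬ S2.

So the purity content of S2 / Sray (exclusion of a complex scaling dimension `Δ ± iπ/log 2`) is invisible even to
reflection positivity and complete monotonicity ALONG THE AXIS; a proof must use genuinely more (e.g. the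
off-axis structure of `⟨σ₀σ_x⟩_{β_c}`, or the Ising equation of state). [folklore: Bernstein–Widder; Euler's
Gamma integral at complex argument]
-/

noncomputable section

namespace Summit.CriticalPhenomena.Ising3DConformalLimit.Theorems.IsingEuclidUpgradeR2RotInvPowerLaw.Negative

open Filter Topology MeasureTheory Set

/-- Log-convexity of the Laplace gauge at a midpoint: `h((x+y)/2)² ≤ h(x) h(y)` (the `2 × 2` case of half-line
reflection positivity). -/
theorem h_midpoint_sq_le {w h : ℝ → ℝ} {ζ : ℂ} (hζ : ‖ζ‖ = 1) (hw : ∀ t, w t = 1 + (1 / 2) * (ζ * (t : ℂ) ^ (((2 * Real.pi / Real.log 2 : ℝ) : ℂ) * Complex.I)).re) (hh : ∀ r, h r = ∫ t in Ioi (0 : ℝ), Real.exp (-(r * t)) * w t) {x y : ℝ} (hx : 0 < x) (hy : 0 < y) :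
    h ((x + y) / 2) ^ 2 ≤ h x * h y := by
  have hPD := h_posDef hζ hw hh ![x / 2, y / 2] ![h ((x + y) / 2), -h x]
    (fun a => by fin_cases a <;> simp <;> positivity)
  simp only [Fin.sum_univ_two, Matrix.cons_val_zero, Matrix.cons_val_one] at hPD
  have e1 : x / 2 + x / 2 = x := by ring
  have e2 : x / 2 + y / 2 = (x + y) / 2 := by ring
  have e3 : y / 2 + x / 2 = (x + y) / 2 := by ring
  have e4 : y / 2 + y / 2 = y := by ring
  rw [e1, e2, e3, e4] at hPD
  have hb := (h_bounds hζ hw hh hx).1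
  have h2x : 0 < 1 / (2 * x) := by positivity
  have hxpos : 0 < h x := by linarith
  have hprod : 0 ≤ h x * (h x * h y - h ((x + y) / 2) ^ 2) := by
    have := hPD
    ring_nf at this ⊢
    linarith
  have := (mul_nonneg_iff_of_pos_left hxpos).1 hprod
  linarith

/-! ## The sequence `g n = h (max n ½)` (hypothesis `hg`) -/

/-- `g n = h n` for `n ≥ 1`. -/
theorem g_of_one_le {h : ℝ → ℝ} {g : ℕ → ℝ} (hg : ∀ n : ℕ, g n = h (max (n : ℝ) (1 / 2))) {n : ℕ} (hn : 1 ≤ n) : g n = h n := by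
  rw [hg, max_eq_left]
  have : (1 : ℝ) ≤ n := by exact_mod_cast hn
  linarith

/-- `g` is positive. -/
theorem g_pos {w h : ℝ → ℝ} {g : ℕ → ℝ} {ζ : ℂ} (hζ : ‖ζ‖ = 1) (hw : ∀ t, w t = 1 + (1 / 2) * (ζ * (t : ℂ) ^ (((2 * Real.pi / Real.log 2 : ℝ) : ℂ) * Complex.I)).re) (hh : ∀ r, h r = ∫ t in Ioi (0 : ℝ), Real.exp (-(r * t)) * w t) (hg : ∀ n : ℕ, g n = h (max (n : ℝ) (1 / 2))) (n : ℕ) : 0 < g n := by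
  rw [hg]
  have hm : (0 : ℝ) < max (n : ℝ) (1 / 2) := lt_of_lt_of_le (by norm_num) (le_max_right _ _)
  have := (h_bounds hζ hw hh hm).1
  have : 0 < 1 / (2 * max (n : ℝ) (1 / 2)) := by positivity
  linarith

/-- `g` is nonincreasing. -/
theorem g_succ_le {w h : ℝ → ℝ} {g : ℕ → ℝ} {ζ : ℂ} (hζ : ‖ζ‖ = 1) (hw : ∀ t, w t = 1 + (1 / 2) * (ζ * (t : ℂ) ^ (((2 * Real.pi / Real.log 2 : ℝ) : ℂ) * Complex.I)).re) (hh : ∀ r, h r = ∫ t in Ioi (0 : ℝ), Real.exp (-(r * t)) * w t) (hg : ∀ n : ℕ, g n = h (max (n : ℝ) (1 / 2))) (n : ℕ) : g (n + 1) ≤ g n := by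
  rw [hg, hg]
  refine h_antitone hζ hw hh (lt_of_lt_of_le (by norm_num) (le_max_right _ _)) ?_
  push_cast
  exact max_le_max (by linarith) le_rfl

/-- `g` is log-convex: `g(n)² ≤ g(n-1) g(n+1)` for `n ≥ 1`. -/
theorem g_sq_le {w h : ℝ → ℝ} {g : ℕ → ℝ} {ζ : ℂ} (hζ : ‖ζ‖ = 1) (hw : ∀ t, w t = 1 + (1 / 2) * (ζ * (t : ℂ) ^ (((2 * Real.pi / Real.log 2 : ℝ) : ℂ) * Complex.I)).re) (hh : ∀ r, h r = ∫ t in Ioi (0 : ℝ), Real.exp (-(r * t)) * w t) (hg : ∀ n : ℕ, g n = h (max (n : ℝ) (1 / 2))) {n : ℕ} (hn : 1 ≤ n) :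
    g n ^ 2 ≤ g (n - 1) * g (n + 1) := by
  rcases Nat.lt_or_ge n 2 with h1 | h2
  · -- n = 1: g 1² ≤ g 0 · g 2 = h(1/2) · h 2 = (2 h 1)(h 1 / 2)
    obtain rfl : n = 1 := by omega
    have e0 : g 0 = h (1 / 2) := by rw [hg]; norm_num
    have e1 : g 1 = h 1 := by rw [g_of_one_le hg le_rfl, Nat.cast_one]
    have e2 : g 2 = h 1 / 2 := by
      rw [g_of_one_le hg (by norm_num), show ((2 : ℕ) : ℝ) = 2 * 1 by norm_num, h_two_mul hw hh]
    have e3 : h 1 = h (1 / 2) / 2 := by rw [show (1 : ℝ) = 2 * (1 / 2) by norm_num, h_two_mul hw hh]; norm_num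
    rw [show (1 - 1 : ℕ) = 0 from rfl, e0, e1, e2]
    have e3' : h (1 / 2) = 2 * h 1 := by linarith
    rw [e3']
    exact le_of_eq (by ring)
  · have hm1 : 1 ≤ n - 1 := by omega
    rw [g_of_one_le hg hn, g_of_one_le hg hm1, g_of_one_le hg (by omega)]
    have hx : (0 : ℝ) < ((n - 1 : ℕ) : ℝ) := by exact_mod_cast (by omega : 0 < n - 1)
    have hy : (0 : ℝ) < ((n + 1 : ℕ) : ℝ) := by exact_mod_cast (by omega : 0 < n + 1)
    have key := h_midpoint_sq_le hζ hw hh hx hy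
    have e : (((n - 1 : ℕ) : ℝ) + ((n + 1 : ℕ) : ℝ)) / 2 = n := by
      rw [Nat.cast_sub hn]; push_cast; ring
    rwa [e] at key

/-- `g` is positive definite on the half-line semigroup (axis reflection positivity). -/
theorem g_posDef {w h : ℝ → ℝ} {g : ℕ → ℝ} {ζ : ℂ} (hζ : ‖ζ‖ = 1) (hw : ∀ t, w t = 1 + (1 / 2) * (ζ * (t : ℂ) ^ (((2 * Real.pi / Real.log 2 : ℝ) : ℂ) * Complex.I)).re) (hh : ∀ r, h r = ∫ t in Ioi (0 : ℝ), Real.exp (-(r * t)) * w t) (hg : ∀ n : ℕ, g n = h (max (n : ℝ) (1 / 2)))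
    {m : ℕ} (p : Fin m → ℕ) (c : Fin m → ℝ) (hp : ∀ a, 1 ≤ p a) :
    0 ≤ ∑ a, ∑ b, c a * c b * g (p a + p b) := by
  have key := h_posDef hζ hw hh (fun a => (p a : ℝ)) c (fun a => by exact_mod_cast hp a)
  refine le_of_le_of_eq key (Finset.sum_congr rfl fun a _ => Finset.sum_congr rfl fun b _ => ?_)
  rw [g_of_one_le hg (le_trans (hp a) (Nat.le_add_right _ _))]
  push_cast
  rfl

/-- `g` lies in the axis envelope: `(1/2)/n² ≤ g n ≤ (3/2)/n` for `n ≥ 1`. -/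
theorem g_envelope {w h : ℝ → ℝ} {g : ℕ → ℝ} {ζ : ℂ} (hζ : ‖ζ‖ = 1) (hw : ∀ t, w t = 1 + (1 / 2) * (ζ * (t : ℂ) ^ (((2 * Real.pi / Real.log 2 : ℝ) : ℂ) * Complex.I)).re) (hh : ∀ r, h r = ∫ t in Ioi (0 : ℝ), Real.exp (-(r * t)) * w t) (hg : ∀ n : ℕ, g n = h (max (n : ℝ) (1 / 2))) {n : ℕ} (hn : 1 ≤ n) :
    (1 / 2) / (n : ℝ) ^ 2 ≤ g n ∧ g n ≤ (3 / 2) / (n : ℝ) := by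
  have hn1 : (1 : ℝ) ≤ n := by exact_mod_cast hn
  have hn0 : (0 : ℝ) < n := by linarith
  obtain ⟨hl, hu⟩ := h_bounds hζ hw hh hn0
  rw [g_of_one_le hg hn]
  constructor
  · calc (1 / 2) / (n : ℝ) ^ 2 ≤ 1 / (2 * n) := by
          rw [div_le_div_iff₀ (by positivity) (by positivity)]; nlinarith
      _ ≤ h n := hl
  · calc h n ≤ 3 / (2 * n) := hu
      _ = (3 / 2) / n := by field_simp

/-- `g` satisfies T1 EXACTLY: `g(2^j)·(2^j)^{2·½} = h 1`. -/
theorem g_tower {w h : ℝ → ℝ} {g : ℕ → ℝ} {ζ : ℂ} (hw : ∀ t, w t = 1 + (1 / 2) * (ζ * (t : ℂ) ^ (((2 * Real.pi / Real.log 2 : ℝ) : ℂ) * Complex.I)).re) (hh : ∀ r, h r = ∫ t in Ioi (0 : ℝ), Real.exp (-(r * t)) * w t) (hg : ∀ n : ℕ, g n = h (max (n : ℝ) (1 / 2))) (j : ℕ) :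
    g (2 ^ j) * ((2 ^ j : ℕ) : ℝ) ^ (2 * (1 / 2 : ℝ)) = h 1 := by
  rw [g_of_one_le hg Nat.one_le_two_pow, show (2 : ℝ) * (1 / 2) = 1 by norm_num, Real.rpow_one]
  push_cast
  rw [← mul_one ((2 : ℝ) ^ j), h_two_pow_mul hw hh 1 j]
  field_simp

/-- **W4 violates S2 at every exponent.** -/
theorem g_not_integerDilationLaw {w h : ℝ → ℝ} {g : ℕ → ℝ} {ζ : ℂ} (hζ : ‖ζ‖ = 1) (hζ' : ζ = (starRingEnd ℂ) (Complex.Gamma (1 + (((2 * Real.pi / Real.log 2 : ℝ) : ℂ) * Complex.I)) * (1 - ((1 / 3 : ℝ) : ℂ) ^ (((2 * Real.pi / Real.log 2 : ℝ) : ℂ) * Complex.I))) / ((‖Complex.Gamma (1 + (((2 * Real.pi / Real.log 2 : ℝ) : ℂ) * Complex.I)) * (1 - ((1 / 3 : ℝ) : ℂ) ^ (((2 * Real.pi / Real.log 2 : ℝ) : ℂ) * Complex.I))‖ : ℝ) : ℂ)) (hw : ∀ t, w t = 1 + (1 / 2) * (ζ * (t : ℂ) ^ (((2 * Real.pi / Real.log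 2 : ℝ) : ℂ) * Complex.I)).re) (hh : ∀ r, h r = ∫ t in Ioi (0 : ℝ), Real.exp (-(r * t)) * w t) (hg : ∀ n : ℕ, g n = h (max (n : ℝ) (1 / 2))) (Δ : ℝ) :
    ¬ (∀ k : ℕ, 1 ≤ k → Tendsto (fun n : ℕ => g (k * n) * (k : ℝ) ^ (2 * Δ) / g n) atTop (𝓝 1)) := by
  intro hS
  have gpos := g_pos hζ hw hh hg
  -- k = 2 forces 2Δ = 1
  have h2 := hS 2 (by norm_num)
  have e2 : ∀ n : ℕ, 1 ≤ n → g (2 * n) * ((2 : ℕ) : ℝ) ^ (2 * Δ) / g n = (2 : ℝ) ^ (2 * Δ) / 2 := by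
    intro n hn
    rw [g_of_one_le hg (by omega), g_of_one_le hg hn]
    push_cast
    rw [h_two_mul hw hh]
    have : h n ≠ 0 := by rw [← g_of_one_le hg hn]; exact (gpos n).ne'
    field_simp
  have lim2 : Tendsto (fun n : ℕ => g (2 * n) * ((2 : ℕ) : ℝ) ^ (2 * Δ) / g n) atTop (𝓝 ((2 : ℝ) ^ (2 * Δ) / 2)) :=
    tendsto_const_nhds.congr' ((eventually_ge_atTop 1).mono fun n hn => (e2 n hn).symm)
  have key : (2 : ℝ) ^ (2 * Δ) / 2 = 1 := tendsto_nhds_unique lim2 h2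
  have hΔ : 2 * Δ = 1 := rpow_two_inj (by rw [Real.rpow_one]; linarith)
  -- k = 3 along the dyadic tower: the constant 3 h 3 / h 1
  have h3 := (hS 3 (by norm_num)).comp (tendsto_pow_atTop_atTop_of_one_lt one_lt_two)
  have e3 : ((fun n : ℕ => g (3 * n) * ((3 : ℕ) : ℝ) ^ (2 * Δ) / g n) ∘ fun j : ℕ => 2 ^ j) =
      fun _ => 3 * h 3 / h 1 := by
    funext j
    simp only [Function.comp_apply]
    have h31 : 1 ≤ 3 * 2 ^ j := by have := Nat.one_le_two_pow (n := j); omega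
    rw [g_of_one_le hg h31, g_of_one_le hg Nat.one_le_two_pow, hΔ, Real.rpow_one]
    push_cast
    rw [show (3 : ℝ) * 2 ^ j = 2 ^ j * 3 by ring, h_two_pow_mul hw hh 3 j, ← mul_one ((2 : ℝ) ^ j),
      h_two_pow_mul hw hh 1 j]
    have : h 1 ≠ 0 := by rw [← Nat.cast_one, ← g_of_one_le hg le_rfl]; exact (gpos 1).ne'
    field_simp
  rw [e3] at h3
  have h13 : 3 * h 3 / h 1 = 1 := tendsto_nhds_unique tendsto_const_nhds h3
  have hpos := h_one_sub_three_mul_h_three hζ' hw hh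
  have : h 1 ≠ 0 := by rw [← Nat.cast_one, ← g_of_one_le hg le_rfl]; exact (gpos 1).ne'
  field_simp at h13
  linarith

/-- **F2′ — the axis toolkit does not see S2.** For sequences `g : ℕ → ℝ`: positivity, monotonicity
(`g(n+1) ≤ g(n)`), log-convexity (`g(n)² ≤ g(n-1)g(n+1)`, `n ≥ 1`), positive definiteness on the half-line
semigroup (`Σ c_a c_b g(p_a+p_b) ≥ 0`, `p_a ≥ 1` — axis reflection positivity), the envelope `c/n² ≤ g ≤ C/n`
and the dyadic tower law T1 together do NOT imply the integer dilation law S2 at any exponent (witness W4).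
[folklore: Bernstein–Widder; discrete scale invariance] -/
theorem lap_integerDilationLaw_not_of_axisToolkit :
    ¬ ∀ g : ℕ → ℝ, (∀ n, 0 < g n) → (∀ n, g (n + 1) ≤ g n) → (∀ n, 1 ≤ n → g n ^ 2 ≤ g (n - 1) * g (n + 1)) →
      (∀ (m : ℕ) (p : Fin m → ℕ) (c : Fin m → ℝ), (∀ a, 1 ≤ p a) → 0 ≤ ∑ a, ∑ b, c a * c b * g (p a + p b)) →
      (∃ c C : ℝ, 0 < c ∧ ∀ n : ℕ, 1 ≤ n → c / (n : ℝ) ^ 2 ≤ g n ∧ g n ≤ C / (n : ℝ)) →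
      (∃ Δ c : ℝ, 0 < c ∧ Tendsto (fun j : ℕ => g (2 ^ j) * ((2 ^ j : ℕ) : ℝ) ^ (2 * Δ)) atTop (𝓝 c)) →
      ∃ Δ : ℝ, (∀ k : ℕ, 1 ≤ k → Tendsto (fun n : ℕ => g (k * n) * (k : ℝ) ^ (2 * Δ) / g n) atTop (𝓝 1)) := by
  intro hall
  set a : ℂ := (((2 * Real.pi / Real.log 2 : ℝ) : ℂ) * Complex.I) with ha
  set z : ℂ := Complex.Gamma (1 + a) * (1 - ((1 / 3 : ℝ) : ℂ) ^ a) with hz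
  have hz0 : z ≠ 0 := mul_ne_zero gamma_ne_zero' (sub_ne_zero.2 (Ne.symm third_cpow_tau_I_ne_one))
  set ζ : ℂ := (starRingEnd ℂ) z / ((‖z‖ : ℝ) : ℂ) with hζdef
  have hζ : ‖ζ‖ = 1 := norm_phase hz0
  set w : ℝ → ℝ := fun t => 1 + (1 / 2) * (ζ * (t : ℂ) ^ a).re with hwdef
  have hw : ∀ t, w t = 1 + (1 / 2) * (ζ * (t : ℂ) ^ a).re := fun t => rfl
  set h : ℝ → ℝ := fun r => ∫ t in Ioi (0 : ℝ), Real.exp (-(r * t)) * w t with hhdef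
  have hh : ∀ r, h r = ∫ t in Ioi (0 : ℝ), Real.exp (-(r * t)) * w t := fun r => rfl
  set g : ℕ → ℝ := fun n => h (max (n : ℝ) (1 / 2)) with hgdef
  have hg : ∀ n : ℕ, g n = h (max (n : ℝ) (1 / 2)) := fun n => rfl
  have h1pos : 0 < h 1 := by
    have := (h_bounds hζ hw hh one_pos).1
    have : (0 : ℝ) < 1 / (2 * 1) := by norm_num
    linarith
  obtain ⟨Δ, hΔ⟩ := hall g (g_pos hζ hw hh hg) (g_succ_le hζ hw hh hg) (fun n hn => g_sq_le hζ hw hh hg hn)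
    (fun m p c hp => g_posDef hζ hw hh hg p c hp) ⟨1 / 2, 3 / 2, by norm_num, fun n hn => g_envelope hζ hw hh hg hn⟩
    ⟨1 / 2, h 1, h1pos, tendsto_const_nhds.congr fun j => (g_tower hw hh hg j).symm⟩
  exact g_not_integerDilationLaw hζ rfl hw hh hg Δ hΔ

end Summit.CriticalPhenomena.Ising3DConformalLimit.Theorems.IsingEuclidUpgradeR2RotInvPowerLaw.Negative

end
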